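import Literature.Probability.RandomPlanarGeometry.RestrictionHullsRiemannProofs
import Literature.Probability.RandomPlanarGeometry.ModulusSymmetry

/-!
# An explicit uniformizing map of the upper half-disc, with boundary values on the diameter

Helper file for route CardyAnchoredRigidity, item stmt-CriticalPhenomena-14488
(`StretchedPullbackNotTargetBlind`).

The negative Joukowski map `J w = -(w + w⁻¹)` is a conformal equivalence of the upper half-disc
`𝔻⁺ = 𝔻 ∩ ℍ` onto `ℍ` (tree: `Complex.bijOn_negJoukowski` and companions, file
`Literature.Analysis.Complex.SymmetricRiemannMap`; cf. the existential
`exists_conformalEquiv_negJoukowski` of `RestrictionHullsRiemannProofs`, here made a named equivalence). Composing its inverse with the Möbius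
involution `z ↦ -1/z` of `ℍ` gives a conformal equivalence `halfDiscChart : ℍ → 𝔻⁺` whose boundary
value at the real point `p / (1 + p²)` is the point `p` of the diameter, for EVERY `p ∈ (-1, 1)`
(`halfDiscChart_hasBoundaryValue`). This is the bridge between the tree's uniformizing data
(`ConformalEquiv upperHalfPlaneSet _`, `HasBoundaryValue`) and conformal maps defined on the
half-disc, with an explicit, smooth boundary correspondence along the diameter.
Elementary; no named facts.
-/

noncomputable section

open Set Filter Topology Complex Metric
open UpperHalfPlane (upperHalfPlaneSet isOpen_upperHalfPlaneSet)

namespace Summit.CriticalPhenomena.CardyFormulaZ2.Theorems.StretchedPullback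

open Literature.Probability.RandomPlanarGeometry

/-- The upper half-disc `𝔻⁺ = 𝔻 ∩ ℍ`. -/
def halfDisc : Set ℂ := ball (0 : ℂ) 1 ∩ upperHalfPlaneSet

/-- The negative Joukowski map `J w = -(w + w⁻¹)`. -/
def negJ (w : ℂ) : ℂ := -(w + w⁻¹)

/-- `negJ` is literally the tree's `fun w ↦ -(w + w⁻¹)`. -/
theorem negJ_def : negJ = fun w : ℂ => -(w + w⁻¹) := rfl

/-- `J` as a conformal equivalence `𝔻⁺ → ℍ`. -/
def joukowskiEquiv : ConformalEquiv halfDisc upperHalfPlaneSet :=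
  ConformalEquiv.ofBijOn negJ
    (Complex.differentiableOn_negJoukowski.mono fun _ hw => ne_zero_of_mem_halfDisc hw)
    Complex.bijOn_negJoukowski Complex.differentiableOn_invFunOn_negJoukowski

/-- `joukowskiEquiv` acts as `J`. -/
@[simp] theorem joukowskiEquiv_apply (w : ℂ) : joukowskiEquiv w = negJ w := rfl

/-- The Möbius involution `z ↦ -1/z` of `ℍ` (matrix `(0, -1; 1, 0)`). -/
def negInvEquiv : ConformalEquiv upperHalfPlaneSet upperHalfPlaneSet :=
  ConformalEquiv.moebius (invShiftSL 0)

/-- `negInvEquiv z = -1/z`. -/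
theorem negInvEquiv_apply (z : ℂ) : negInvEquiv z = -z⁻¹ := by
  show moebiusFun (invShiftSL 0) z = -z⁻¹
  simp only [moebiusFun, invShiftSL_apply_00, invShiftSL_apply_01, invShiftSL_apply_10,
    invShiftSL_apply_11]
  push_cast
  ring

/-- **The explicit uniformizing map of the half-disc**: `z ↦ J⁻¹ (-1/z)`, a conformal equivalence
`ℍ → 𝔻⁺`. -/
def halfDiscChart : ConformalEquiv upperHalfPlaneSet halfDisc :=
  negInvEquiv.trans joukowskiEquiv.symm

/-- The chart takes values in the half-disc. -/
theorem halfDiscChart_mem {z : ℂ} (hz : z ∈ upperHalfPlaneSet) : halfDiscChart z ∈ halfDisc :=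
  halfDiscChart.mapsTo hz

/-- `J (halfDiscChart z) = -1/z` on `ℍ`. -/
theorem negJ_halfDiscChart {z : ℂ} (hz : z ∈ upperHalfPlaneSet) :
    negJ (halfDiscChart z) = -z⁻¹ := by
  have h1 : negInvEquiv z ∈ upperHalfPlaneSet := negInvEquiv.mapsTo hz
  have h2 : joukowskiEquiv (joukowskiEquiv.symm (negInvEquiv z)) = negInvEquiv z := by
    rw [ConformalEquiv.symm_apply_eq]
    exact joukowskiEquiv.toPartialEquiv.right_inv' (by rw [joukowskiEquiv.target_eq]; exact h1)
  rw [← negInvEquiv_apply]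
  exact h2

/-! ### The boundary correspondence along the diameter -/

/-- The boundary parameter of the diameter point `p`: `u p = p / (1 + p²)` (`= -1 / J p` for
`p ≠ 0`). -/
def diamParam (p : ℝ) : ℝ := p / (1 + p ^ 2)

/-- `u 0 = 0`. -/
@[simp] theorem diamParam_zero : diamParam 0 = 0 := by simp [diamParam]

/-- `u` is strictly increasing on `[-1, 1]`. -/
theorem strictMonoOn_diamParam : StrictMonoOn diamParam (Icc (-1) 1) := by
  intro p hp q hq hpq
  simp only [diamParam]
  rw [div_lt_div_iff₀ (by positivity) (by positivity)]
  have h1 : p * q < 1 := by nlinarith [hp.1, hp.2, hq.1, hq.2]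
  nlinarith

/-- `u` is injective on `(-1, 1)`. -/
theorem diamParam_injOn : InjOn diamParam (Ioo (-1) 1) :=
  (strictMonoOn_diamParam.mono Ioo_subset_Icc_self).injOn

/-- `u p` has the sign of `p`: positive for `p > 0`. -/
theorem diamParam_pos {p : ℝ} (hp : 0 < p) : 0 < diamParam p := div_pos hp (by positivity)

/-- `u p < 0` for `p < 0`. -/
theorem diamParam_neg {p : ℝ} (hp : p < 0) : diamParam p < 0 :=
  div_neg_of_neg_of_pos hp (by positivity)

/-- Two-sided comparison of `u p` with `p` for `0 ≤ p ≤ 1`: `p / 2 ≤ u p ≤ p`. -/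
theorem diamParam_le_self {p : ℝ} (hp : 0 ≤ p) : diamParam p ≤ p := by
  rw [diamParam, div_le_iff₀ (by positivity)]
  nlinarith [sq_nonneg p]

/-- `p / 2 ≤ u p` for `0 ≤ p ≤ 1`. -/
theorem half_le_diamParam {p : ℝ} (hp : 0 ≤ p) (hp1 : p ≤ 1) : p / 2 ≤ diamParam p := by
  rw [diamParam, le_div_iff₀ (by positivity)]
  nlinarith [sq_nonneg p]

/-- `-1 / (u p) = J p` for `p ≠ 0`. -/
theorem neg_inv_diamParam {p : ℝ} (hp : p ≠ 0) :
    -((diamParam p : ℝ) : ℂ)⁻¹ = negJ (p : ℂ) := by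
  have hp' : (p : ℂ) ≠ 0 := ofReal_ne_zero.2 hp
  have h1 : ((1 + p ^ 2 : ℝ) : ℂ) ≠ 0 := ofReal_ne_zero.2 (by positivity : (0 : ℝ) < 1 + p ^ 2).ne'
  rw [diamParam, negJ, ofReal_div, inv_div]
  push_cast
  field_simp
  ring

/-- `|J p| > 2` for real `0 < |p| < 1`. -/
theorem two_lt_norm_negJ_ofReal {p : ℝ} (hp : p ≠ 0) (hp1 : |p| < 1) : 2 < ‖negJ (p : ℂ)‖ := by
  have hJ : negJ (p : ℂ) = ((-(p + p⁻¹) : ℝ) : ℂ) := by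
    simp [negJ]
  rw [hJ, Complex.norm_real, Real.norm_eq_abs, abs_neg]
  have hsq : (p + p⁻¹) ^ 2 = (p - p⁻¹) ^ 2 + 4 := by
    field_simp
    ring
  have hne : p - p⁻¹ ≠ 0 := by
    intro h
    have h1 : p * p = 1 := by
      field_simp at h
      nlinarith [h]
    have h2 : |p| * |p| = 1 := by rw [← abs_mul, h1, abs_one]
    nlinarith [abs_nonneg p]
  have h4 : (2 : ℝ) ^ 2 < (p + p⁻¹) ^ 2 := by
    rw [hsq]
    have := pow_pos (abs_pos.2 hne) 2
    rw [pow_abs] at this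
    have h5 : 0 < (p - p⁻¹) ^ 2 := by positivity
    linarith
  have := sq_lt_sq.1 h4
  rwa [abs_of_pos (by norm_num : (0 : ℝ) < 2)] at this

/-- `|J w| ≤ 2` on the unit circle. -/
theorem norm_negJ_le_two_of_norm_eq_one {w : ℂ} (hw : ‖w‖ = 1) : ‖negJ w‖ ≤ 2 :=
  calc ‖negJ w‖ = ‖-(w + w⁻¹)‖ := rfl
    _ ≤ ‖w‖ + ‖w‖⁻¹ := Complex.norm_negJoukowski_le w
    _ = 2 := by rw [hw]; norm_num

/-- **Boundary value of the chart at `0`**: `halfDiscChart z → 0` as `z → 0` in `ℍ`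
(`-1/z → ∞` and `J⁻¹(∞) = 0`). -/
theorem halfDiscChart_hasBoundaryValue_zero : halfDiscChart.HasBoundaryValue 0 0 := by
  unfold ConformalEquiv.HasBoundaryValue
  have hmem : ∀ᶠ z in 𝓝[upperHalfPlaneSet] (0 : ℂ), halfDiscChart z ∈ ball (0 : ℂ) 1 := by
    filter_upwards [self_mem_nhdsWithin] with z hz using (halfDiscChart_mem hz).1
  refine Complex.tendsto_zero_of_tendsto_negJoukowski hmem ?_
  -- `J (chart z) = -1/z → ∞`
  have h1 : Tendsto (fun z : ℂ => -z⁻¹) (𝓝[upperHalfPlaneSet] (0 : ℂ)) (cocompact ℂ) := by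
    have h2 : Tendsto (fun z : ℂ => -z⁻¹) (𝓝[≠] (0 : ℂ)) (cocompact ℂ) := by
      rw [← cobounded_eq_cocompact, ← tendsto_norm_atTop_iff_cobounded]
      simpa only [norm_neg] using (tendsto_norm_inv_nhdsNE_zero_atTop (α := ℂ))
    refine h2.mono_left (nhdsWithin_mono _ fun z hz => ?_)
    rintro rfl
    have h : (0 : ℝ) < (0 : ℂ).im := hz
    simp at h
  refine h1.congr' ?_
  filter_upwards [self_mem_nhdsWithin] with z hz
  rw [← negJ_halfDiscChart hz, negJ]

/-- **Boundary values of the chart on the diameter**: for every `p ∈ (-1, 1)`,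
`halfDiscChart z → p` as `z → p / (1 + p²)` in `ℍ`. Proof: the values lie in the compact closed
disc; a cluster point `w` satisfies `J w = J p` (continuity of `J` off `0`; `w = 0` is excluded by
the pole of `J`), and `J w = J p` with `|w| ≤ 1` forces `w = p` (injectivity of `J` on the
punctured disc; on the circle `|J| ≤ 2 < |J p|`). -/
theorem halfDiscChart_hasBoundaryValue {p : ℝ} (hp : p ∈ Ioo (-1 : ℝ) 1) :
    halfDiscChart.HasBoundaryValue (diamParam p : ℝ) p := by
  rcases eq_or_ne p 0 with rfl | hp0
  · rw [diamParam_zero]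
    exact_mod_cast halfDiscChart_hasBoundaryValue_zero
  unfold ConformalEquiv.HasBoundaryValue
  set l : Filter ℂ := 𝓝[upperHalfPlaneSet] ((diamParam p : ℝ) : ℂ) with hl
  have hpabs : |p| < 1 := abs_lt.2 ⟨hp.1, hp.2⟩
  have hpball : (p : ℂ) ∈ ball (0 : ℂ) 1 \ {0} := by
    refine ⟨?_, fun h => hp0 (ofReal_eq_zero.1 h)⟩
    rw [mem_ball_zero_iff, Complex.norm_real, Real.norm_eq_abs]
    exact hpabs
  have hx0 : ((diamParam p : ℝ) : ℂ) ≠ 0 := by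
    rw [ofReal_ne_zero]
    exact div_ne_zero hp0 (by positivity : (0 : ℝ) < 1 + p ^ 2).ne'
  -- values in the compact closed disc
  have hmem : ∀ᶠ z in l, halfDiscChart z ∈ closedBall (0 : ℂ) 1 := by
    filter_upwards [self_mem_nhdsWithin] with z hz using ball_subset_closedBall (halfDiscChart_mem hz).1
  -- `J ∘ chart → J p`
  have hJ : Tendsto (fun z => negJ (halfDiscChart z)) l (𝓝 (negJ p)) := by
    have h1 : Tendsto (fun z : ℂ => -z⁻¹) l (𝓝 (negJ p)) := by
      rw [← neg_inv_diamParam hp0]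
      exact ((continuousAt_inv₀ hx0).neg.tendsto).mono_left nhdsWithin_le_nhds
    refine h1.congr' ?_
    filter_upwards [self_mem_nhdsWithin] with z hz
    rw [negJ_halfDiscChart hz]
  refine (isCompact_closedBall (0 : ℂ) 1).tendsto_nhds_of_unique_mapClusterPt hmem ?_
  intro w hw hcl
  by_cases hw0 : w = 0
  · -- the pole of `J` at `0` is incompatible with `J ∘ chart → J p`
    exfalso
    subst hw0
    have hfar : ∀ᶠ w' in 𝓝[≠] (0 : ℂ), negJ w' ∈ (closedBall (negJ (p : ℂ)) 1)ᶜ := by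
      have := Complex.tendsto_negJoukowski_nhdsNE_zero.eventually_mem
        ((isCompact_closedBall (negJ (p : ℂ)) 1).compl_mem_cocompact)
      exact this
    rw [eventually_nhdsWithin_iff, Metric.eventually_nhds_iff] at hfar
    obtain ⟨δ, hδ, hfar⟩ := hfar
    have hnear : ∀ᶠ z in l, negJ (halfDiscChart z) ∈ ball (negJ (p : ℂ)) 1 ∧ z ∈ upperHalfPlaneSet :=
      (hJ.eventually_mem (ball_mem_nhds _ one_pos)).and self_mem_nhdsWithin
    have hfreq : ∃ᶠ z in l, halfDiscChart z ∈ ball (0 : ℂ) δ :=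
      (mapClusterPt_iff_frequently.1 hcl) _ (ball_mem_nhds _ hδ)
    obtain ⟨z, hz, hzJ, hzH⟩ := (hfreq.and_eventually hnear).exists
    have hne : halfDiscChart z ≠ 0 := ne_zero_of_mem_halfDisc (halfDiscChart_mem hzH)
    have := hfar (mem_ball.1 hz) hne
    exact this (ball_subset_closedBall hzJ)
  · -- `J w = J p`
    have hcont : ContinuousAt negJ w := (Complex.hasDerivAt_negJoukowski hw0).continuousAt
    have hcl' : MapClusterPt (negJ w) l (negJ ∘ halfDiscChart) := hcl.continuousAt_comp hcont
    have hJw : negJ w = negJ p := eq_of_nhds_neBot (hcl'.clusterPt.mono hJ).neBot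
    rcases (mem_closedBall_zero_iff.1 hw).lt_or_eq with hlt | heq
    · exact Complex.injOn_negJoukowski ⟨mem_ball_zero_iff.2 hlt, hw0⟩ hpball hJw
    · exfalso
      have h1 := norm_negJ_le_two_of_norm_eq_one heq
      have h2 := two_lt_norm_negJ_ofReal hp0 hpabs
      rw [hJw] at h1
      linarith

end Summit.CriticalPhenomena.CardyFormulaZ2.Theorems.StretchedPullback
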